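import Mathlib
import Summits.AtomisticToContinuum.Crystallization.Theorems.HolmgrenBoyleLindHalfSpaceRigidityPeriodic
import Summits.AtomisticToContinuum.Crystallization.Theorems.HolmgrenBoyleLindFLCEquilibriumPeriodic

/-!
# Route `HolmgrenBoyleLind`, crux `HalfSpaceUniqueContinuation`: the period-rank ladder reduced to
three unique-continuation cores (stub `stub_rungsOfCores` of line `registered`)

Support file for the crux item stmt-AtomisticToContinuum-6075 (`HalfSpaceUniqueContinuation`, UC;
⟺ `FLCEquilibriumPeriodic`, «every FLC Delone Lennard-Jones equilibrium of `ℝ³` is periodic»,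
`flcEquilibriumPeriodic_iff_uc`). The registered skeleton
`Cruxes/HalfSpaceUniqueContinuation/Lines/birth.lean` proves the crux from four stubs: three
UNIQUE-CONTINUATION CORES `stub_ucRank0/1/2` (UC for `Λ` of period rank exactly 0 / 1 / 2, the
last two only for half-spaces whose normal is orthogonal to the periods) and the REDUCTION
`stub_rungsOfCores : core₀ → core₁ → core₂ → FLCEquilibriumPeriodic`, proved here (sorry-free)
from potential-free geometry:

* `hbl_period_neg`, `hbl_period_nsmul` — closure properties of periods `t` (`∀ x, x + t ∈ ω ↔ x ∈ ω`);
* `hbl_hull_period` — a period of `Λ` is a period of every element of the patch-hull of `Λ`;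
* `hbl_eq_of_agree_of_inner_ne_zero` — SWEEPING: two sets with a common period `t`, `⟪t, u⟫ ≠ 0`,
  that agree on the open half-space `{⟪z, u⟫ < a}` are equal; hence the normal of a coincidence
  half-space of a DISTINCT hull pair is orthogonal to every period of `Λ`;
* `hbl_span_eq_top_or_pair` — the FLC dichotomy extracted from the proof of
  `HalfSpaceRigidityPeriodic`: the periods of a `δ`-separated, `r`-dense, FLC `Λ ⊆ ℝ³` span `ℝ³`,
  or its patch-hull contains `ω ≠ ω'` agreeing on an open half-space through `0`;
* `hbl_span_singleton_ne_top`, `hbl_span_eq_top_of_three` — linear algebra in `ℝ³`;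
* `stub_rungsOfCores` — the ladder: rank 0 ⇒ a period (else the dichotomy pair is identified by
  core₀), rank 1 ⇒ a second independent period (the pair's normal is `⊥ t` by sweeping, core₁),
  rank 2 ⇒ the periods span (normal `⊥ s, t`, core₂), and spanning periods of a uniformly discrete
  relatively dense set give `Λ = F + G` (`exists_periodicConfiguration_of_span_eq_top`).

All `[folklore]`; nothing here closes an item (the three cores are open).
-/

noncomputable section

namespace Summit.AtomisticToContinuum.Crystallization.Theorems.HolmgrenBoyleLind

open scoped BigOperators Topology InnerProductSpace
open Literature.MathematicalPhysics.StatisticalMechanics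
open Summit.AtomisticToContinuum.Crystallization.Theses.HolmgrenBoyleLind
open Summit.AtomisticToContinuum.Crystallization.Theorems

/-! ## Periods -/

/-- The negative of a period is a period. [folklore] -/
theorem hbl_period_neg {ω : Set (EuclideanSpace ℝ (Fin 3))} {t : EuclideanSpace ℝ (Fin 3)}
    (ht : ∀ x : EuclideanSpace ℝ (Fin 3), x + t ∈ ω ↔ x ∈ ω) :
    ∀ x : EuclideanSpace ℝ (Fin 3), x + -t ∈ ω ↔ x ∈ ω := by
  intro x
  have h := ht (x + -t)
  rw [neg_add_cancel_right] at h
  exact h.symm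

/-- Natural multiples of a period are periods. [folklore] -/
theorem hbl_period_nsmul {ω : Set (EuclideanSpace ℝ (Fin 3))} {t : EuclideanSpace ℝ (Fin 3)}
    (ht : ∀ x : EuclideanSpace ℝ (Fin 3), x + t ∈ ω ↔ x ∈ ω) (n : ℕ) :
    ∀ x : EuclideanSpace ℝ (Fin 3), x + (n : ℝ) • t ∈ ω ↔ x ∈ ω := by
  induction n with
  | zero => intro x; simp
  | succ n ih =>
    intro x
    rw [Nat.cast_succ, add_smul, one_smul, ← add_assoc, ht, ih]

/-- **Periods pass to the patch-hull.** A period of `Λ` is a period of every element `ω` of the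
patch-hull of `Λ` (every closed central ball of `ω` is a translate of a `Λ`-patch): read the patch
identity of radius `max ‖x‖ ‖x + t‖` at `x` and at `x + t`. [folklore] -/
theorem hbl_hull_period {Λ ω : Set (EuclideanSpace ℝ (Fin 3))} {t : EuclideanSpace ℝ (Fin 3)}
    (ht : ∀ x : EuclideanSpace ℝ (Fin 3), x + t ∈ Λ ↔ x ∈ Λ)
    (hω : ∀ R : ℝ, ∃ v : EuclideanSpace ℝ (Fin 3),
      {z : EuclideanSpace ℝ (Fin 3) | z ∈ ω ∧ ‖z‖ ≤ R} =
        {z : EuclideanSpace ℝ (Fin 3) | z + v ∈ Λ ∧ ‖z‖ ≤ R}) :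
    ∀ x : EuclideanSpace ℝ (Fin 3), x + t ∈ ω ↔ x ∈ ω := by
  intro x
  obtain ⟨v, hv⟩ := hω (max ‖x‖ ‖x + t‖)
  have h1 := hbl_mem_iff_of_patch_eq (T := {z : EuclideanSpace ℝ (Fin 3) | z + v ∈ Λ}) hv
    (le_max_left ‖x‖ ‖x + t‖)
  have h2 := hbl_mem_iff_of_patch_eq (T := {z : EuclideanSpace ℝ (Fin 3) | z + v ∈ Λ}) hv
    (le_max_right ‖x‖ ‖x + t‖)
  simp only [Set.mem_setOf_eq] at h1 h2
  rw [h2, h1, add_right_comm]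
  exact ht (x + v)

/-! ## Sweeping -/

/-- **Sweeping.** Two sets with a common period `t` transverse to `u` (`⟪t, u⟫ ≠ 0`) that agree on
the open half-space `{⟪z, u⟫ < a}` are equal: push any point into the half-space by a natural
multiple of `±t`. Consequently the normal of a coincidence half-space of a distinct pair of
patch-hull elements is orthogonal to every period of `Λ` (`hbl_hull_period`). [folklore] -/
theorem hbl_eq_of_agree_of_inner_ne_zero {ω ω' : Set (EuclideanSpace ℝ (Fin 3))}
    {t u : EuclideanSpace ℝ (Fin 3)} {a : ℝ}
    (ht : ∀ x : EuclideanSpace ℝ (Fin 3), x + t ∈ ω ↔ x ∈ ω)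
    (ht' : ∀ x : EuclideanSpace ℝ (Fin 3), x + t ∈ ω' ↔ x ∈ ω')
    (htu : inner ℝ t u ≠ 0)
    (hagree : ∀ z : EuclideanSpace ℝ (Fin 3), inner ℝ z u < a → (z ∈ ω ↔ z ∈ ω')) :
    ω = ω' := by
  -- a common period `t'` with `⟪t', u⟫ < 0`
  obtain ⟨t', h1, h2, hneg⟩ : ∃ t' : EuclideanSpace ℝ (Fin 3),
      (∀ x : EuclideanSpace ℝ (Fin 3), x + t' ∈ ω ↔ x ∈ ω) ∧
      (∀ x : EuclideanSpace ℝ (Fin 3), x + t' ∈ ω' ↔ x ∈ ω') ∧ inner ℝ t' u < 0 := by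
    rcases lt_or_gt_of_ne htu with h | h
    · exact ⟨t, ht, ht', h⟩
    · exact ⟨-t, hbl_period_neg ht, hbl_period_neg ht', by rw [inner_neg_left]; linarith⟩
  ext z
  have hpos : 0 < -inner ℝ t' u := by linarith
  obtain ⟨n, hn⟩ := exists_nat_gt ((inner ℝ z u - a) / (-inner ℝ t' u))
  rw [div_lt_iff₀ hpos] at hn
  have hz : inner ℝ (z + (n : ℝ) • t') u < a := by
    rw [inner_add_left, real_inner_smul_left]
    nlinarith
  have key := hagree _ hz
  rwa [hbl_period_nsmul h1 n, hbl_period_nsmul h2 n] at key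

/-! ## The FLC dichotomy -/

/-- **The FLC dichotomy** (the two halves of the proof of `HalfSpaceRigidityPeriodic`): for a
`δ`-separated, `r`-dense `Λ ⊆ ℝ³` of finite local complexity, either the periods of `Λ` span `ℝ³`
(some radius makes equal patches force equal translates, `span_periods_eq_top`), or the patch-hull
of `Λ` contains a distinct pair agreeing on an open half-space through `0`
(`exists_halfSpace_pair`). [folklore] -/
theorem hbl_span_eq_top_or_pair {Λ : Set (EuclideanSpace ℝ (Fin 3))} {δ r : ℝ} (hδ : 0 < δ)
    (hr : 0 < r) (hsep : ∀ x ∈ Λ, ∀ y ∈ Λ, x ≠ y → δ ≤ dist x y)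
    (hden : ∀ c : EuclideanSpace ℝ (Fin 3), ∃ y ∈ Λ, dist y c ≤ r)
    (hFLC : ∀ R : ℝ, Set.Finite {S : Set (EuclideanSpace ℝ (Fin 3)) |
      ∃ x ∈ Λ, S = {v : EuclideanSpace ℝ (Fin 3) | x + v ∈ Λ ∧ ‖v‖ ≤ R}}) :
    Submodule.span ℝ {t : EuclideanSpace ℝ (Fin 3) |
        ∀ x : EuclideanSpace ℝ (Fin 3), x + t ∈ Λ ↔ x ∈ Λ} = ⊤ ∨
      ∃ ω ω' : Set (EuclideanSpace ℝ (Fin 3)),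
        (∀ R : ℝ, ∃ v : EuclideanSpace ℝ (Fin 3),
          {z : EuclideanSpace ℝ (Fin 3) | z ∈ ω ∧ ‖z‖ ≤ R} =
            {z : EuclideanSpace ℝ (Fin 3) | z + v ∈ Λ ∧ ‖z‖ ≤ R}) ∧
        (∀ R : ℝ, ∃ v : EuclideanSpace ℝ (Fin 3),
          {z : EuclideanSpace ℝ (Fin 3) | z ∈ ω' ∧ ‖z‖ ≤ R} =
            {z : EuclideanSpace ℝ (Fin 3) | z + v ∈ Λ ∧ ‖z‖ ≤ R}) ∧
        ∃ u : EuclideanSpace ℝ (Fin 3), u ≠ 0 ∧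
          (∀ z : EuclideanSpace ℝ (Fin 3), ⟪z, u⟫_ℝ < 0 → (z ∈ ω ↔ z ∈ ω')) ∧ ω ≠ ω' := by
  classical
  by_cases hcase : ∃ R : ℝ, ∀ p ∈ Λ, ∀ q ∈ Λ,
      {v : EuclideanSpace ℝ (Fin 3) | p + v ∈ Λ ∧ ‖v‖ ≤ R} =
        {v : EuclideanSpace ℝ (Fin 3) | q + v ∈ Λ ∧ ‖v‖ ≤ R} →
      {v : EuclideanSpace ℝ (Fin 3) | p + v ∈ Λ} = {v : EuclideanSpace ℝ (Fin 3) | q + v ∈ Λ}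
  · left
    obtain ⟨R, hR⟩ := hcase
    refine span_periods_eq_top hden (hFLC R) fun p hp q hq hpq x => ?_
    have h := Set.ext_iff.1 (hR p hp q hq hpq) (x - p)
    simp only [Set.mem_setOf_eq, add_sub_cancel] at h
    rw [show x + (q - p) = q + (x - p) by abel]
    exact h.symm
  · right
    push Not at hcase
    exact exists_halfSpace_pair hδ hr hsep hden hFLC fun R => by
      obtain ⟨p, hp, q, hq, h1, h2⟩ := hcase R
      exact ⟨p, hp, q, hq, h1, h2⟩

/-! ## Linear algebra in `ℝ³` -/

/-- A line is not all of `ℝ³`. [folklore] -/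
theorem hbl_span_singleton_ne_top (t : EuclideanSpace ℝ (Fin 3)) :
    Submodule.span ℝ ({t} : Set (EuclideanSpace ℝ (Fin 3))) ≠ ⊤ := by
  intro h
  have h1 : Module.finrank ℝ (Submodule.span ℝ ({t} : Set (EuclideanSpace ℝ (Fin 3)))) ≤ 1 := by
    simpa using finrank_span_le_card ({t} : Set (EuclideanSpace ℝ (Fin 3)))
  rw [h, finrank_top, finrank_euclideanSpace_fin] at h1
  omega

/-- Three independent vectors (`t ≠ 0`, `s ∉ ℝ t`, `w ∉ ℝ s + ℝ t`) inside a set make its span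
all of `ℝ³` (the chain `ℝ t < ℝ s + ℝ t < ℝ w + ℝ s + ℝ t` raises the dimension to `3`). [folklore] -/
theorem hbl_span_eq_top_of_three {P : Set (EuclideanSpace ℝ (Fin 3))}
    {s t w : EuclideanSpace ℝ (Fin 3)}
    (ht0 : t ≠ 0) (hs : s ∉ Submodule.span ℝ ({t} : Set (EuclideanSpace ℝ (Fin 3))))
    (hw : w ∉ Submodule.span ℝ ({s, t} : Set (EuclideanSpace ℝ (Fin 3))))
    (htP : t ∈ P) (hsP : s ∈ P) (hwP : w ∈ P) :
    Submodule.span ℝ P = ⊤ := by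
  set S1 := Submodule.span ℝ ({t} : Set (EuclideanSpace ℝ (Fin 3))) with hS1
  set S2 := Submodule.span ℝ ({s, t} : Set (EuclideanSpace ℝ (Fin 3))) with hS2
  set S3 := Submodule.span ℝ ({w, s, t} : Set (EuclideanSpace ℝ (Fin 3))) with hS3
  have h1 : Module.finrank ℝ S1 = 1 := finrank_span_singleton ht0
  have h12 : S1 < S2 := by
    refine lt_of_le_of_ne (Submodule.span_mono (by simp)) fun h => hs ?_
    rw [h]
    exact Submodule.subset_span (by simp)
  have h23 : S2 < S3 := by
    refine lt_of_le_of_ne (Submodule.span_mono (by simp)) fun h => hw ?_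
    rw [h]
    exact Submodule.subset_span (by simp)
  have h2 := Submodule.finrank_lt_finrank_of_lt h12
  have h3 := Submodule.finrank_lt_finrank_of_lt h23
  have h4 : Module.finrank ℝ S3 ≤ 3 := by
    have := Submodule.finrank_le S3
    rwa [finrank_euclideanSpace_fin] at this
  have h5 : Module.finrank ℝ S3 = Module.finrank ℝ (EuclideanSpace ℝ (Fin 3)) := by
    rw [finrank_euclideanSpace_fin]; omega
  have h6 : S3 = ⊤ := Submodule.eq_top_of_finrank_eq h5
  rw [eq_top_iff, ← h6]
  exact Submodule.span_mono (by simp [Set.insert_subset_iff, htP, hsP, hwP])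

/-! ## The ladder: three unique-continuation cores give `FLCEquilibriumPeriodic` -/

/-- **The period-rank ladder (registered stub `stub_rungsOfCores` of the crux skeleton).** If
unique continuation across half-spaces holds for the patch-hulls of FLC Delone Lennard-Jones
equilibria of `ℝ³` (i) without non-zero periods, (ii) with periods on a line `ℝ t` and normal
`⊥ t`, (iii) with periods in a plane `ℝ s + ℝ t` and normal `⊥ s, t`, then every FLC Delone
Lennard-Jones equilibrium of `ℝ³` is the point set of a periodic configuration. Rung by rung:
no period ⇒ the FLC dichotomy pair is identified by (i), absurd; a period `t` but none off `ℝ t` ⇒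
the pair's normal is `⊥ t` by sweeping and (ii) identifies it; independent periods `s, t` but a
non-spanning period group ⇒ normal `⊥ s, t` and (iii) identifies it; spanning periods ⇒ `F + G`
(`exists_periodicConfiguration_of_span_eq_top`). [folklore] -/
theorem stub_rungsOfCores :
    (∀ (Λ : Set (EuclideanSpace ℝ (Fin 3))) (δ r : ℝ), 0 < δ → 0 < r →
      (∀ x ∈ Λ, ∀ y ∈ Λ, x ≠ y → δ ≤ dist x y) →
      (∀ c : EuclideanSpace ℝ (Fin 3), ∃ y ∈ Λ, dist y c ≤ r) →
      (∀ R : ℝ, Set.Finite {S : Set (EuclideanSpace ℝ (Fin 3)) |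
        ∃ x ∈ Λ, S = {v : EuclideanSpace ℝ (Fin 3) | x + v ∈ Λ ∧ ‖v‖ ≤ R}}) →
      (∀ x ∈ Λ, HasSum (fun y : {y : EuclideanSpace ℝ (Fin 3) // y ∈ Λ ∧ y ≠ x} =>
        (deriv Literature.MathematicalPhysics.StatisticalMechanics.lennardJones
            (dist x (y : EuclideanSpace ℝ (Fin 3))) /
          dist x (y : EuclideanSpace ℝ (Fin 3))) • (x - (y : EuclideanSpace ℝ (Fin 3)))) 0) →
      (∀ t : EuclideanSpace ℝ (Fin 3), t ≠ 0 →
        ¬ (∀ x : EuclideanSpace ℝ (Fin 3), x + t ∈ Λ ↔ x ∈ Λ)) →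
      ∀ ω ω' : Set (EuclideanSpace ℝ (Fin 3)),
        (∀ R : ℝ, ∃ v : EuclideanSpace ℝ (Fin 3),
          {z : EuclideanSpace ℝ (Fin 3) | z ∈ ω ∧ ‖z‖ ≤ R} =
            {z : EuclideanSpace ℝ (Fin 3) | z + v ∈ Λ ∧ ‖z‖ ≤ R}) →
        (∀ R : ℝ, ∃ v : EuclideanSpace ℝ (Fin 3),
          {z : EuclideanSpace ℝ (Fin 3) | z ∈ ω' ∧ ‖z‖ ≤ R} =
            {z : EuclideanSpace ℝ (Fin 3) | z + v ∈ Λ ∧ ‖z‖ ≤ R}) →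
        ∀ (u : EuclideanSpace ℝ (Fin 3)) (a : ℝ), u ≠ 0 →
          (∀ z : EuclideanSpace ℝ (Fin 3), inner ℝ z u < a → (z ∈ ω ↔ z ∈ ω')) → ω = ω' ) →
    (∀ (Λ : Set (EuclideanSpace ℝ (Fin 3))) (δ r : ℝ), 0 < δ → 0 < r →
      (∀ x ∈ Λ, ∀ y ∈ Λ, x ≠ y → δ ≤ dist x y) →
      (∀ c : EuclideanSpace ℝ (Fin 3), ∃ y ∈ Λ, dist y c ≤ r) →
      (∀ R : ℝ, Set.Finite {S : Set (EuclideanSpace ℝ (Fin 3)) |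
        ∃ x ∈ Λ, S = {v : EuclideanSpace ℝ (Fin 3) | x + v ∈ Λ ∧ ‖v‖ ≤ R}}) →
      (∀ x ∈ Λ, HasSum (fun y : {y : EuclideanSpace ℝ (Fin 3) // y ∈ Λ ∧ y ≠ x} =>
        (deriv Literature.MathematicalPhysics.StatisticalMechanics.lennardJones
            (dist x (y : EuclideanSpace ℝ (Fin 3))) /
          dist x (y : EuclideanSpace ℝ (Fin 3))) • (x - (y : EuclideanSpace ℝ (Fin 3)))) 0) →
      ∀ t : EuclideanSpace ℝ (Fin 3), t ≠ 0 →
        (∀ x : EuclideanSpace ℝ (Fin 3), x + t ∈ Λ ↔ x ∈ Λ) →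
        (∀ s : EuclideanSpace ℝ (Fin 3), (∀ x : EuclideanSpace ℝ (Fin 3), x + s ∈ Λ ↔ x ∈ Λ) →
          s ∈ Submodule.span ℝ ({t} : Set (EuclideanSpace ℝ (Fin 3)))) →
      ∀ ω ω' : Set (EuclideanSpace ℝ (Fin 3)),
        (∀ R : ℝ, ∃ v : EuclideanSpace ℝ (Fin 3),
          {z : EuclideanSpace ℝ (Fin 3) | z ∈ ω ∧ ‖z‖ ≤ R} =
            {z : EuclideanSpace ℝ (Fin 3) | z + v ∈ Λ ∧ ‖z‖ ≤ R}) →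
        (∀ R : ℝ, ∃ v : EuclideanSpace ℝ (Fin 3),
          {z : EuclideanSpace ℝ (Fin 3) | z ∈ ω' ∧ ‖z‖ ≤ R} =
            {z : EuclideanSpace ℝ (Fin 3) | z + v ∈ Λ ∧ ‖z‖ ≤ R}) →
        ∀ (u : EuclideanSpace ℝ (Fin 3)) (a : ℝ), u ≠ 0 → inner ℝ t u = 0 →
          (∀ z : EuclideanSpace ℝ (Fin 3), inner ℝ z u < a → (z ∈ ω ↔ z ∈ ω')) → ω = ω' ) →
    (∀ (Λ : Set (EuclideanSpace ℝ (Fin 3))) (δ r : ℝ), 0 < δ → 0 < r →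
      (∀ x ∈ Λ, ∀ y ∈ Λ, x ≠ y → δ ≤ dist x y) →
      (∀ c : EuclideanSpace ℝ (Fin 3), ∃ y ∈ Λ, dist y c ≤ r) →
      (∀ R : ℝ, Set.Finite {S : Set (EuclideanSpace ℝ (Fin 3)) |
        ∃ x ∈ Λ, S = {v : EuclideanSpace ℝ (Fin 3) | x + v ∈ Λ ∧ ‖v‖ ≤ R}}) →
      (∀ x ∈ Λ, HasSum (fun y : {y : EuclideanSpace ℝ (Fin 3) // y ∈ Λ ∧ y ≠ x} =>
        (deriv Literature.MathematicalPhysics.StatisticalMechanics.lennardJones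
            (dist x (y : EuclideanSpace ℝ (Fin 3))) /
          dist x (y : EuclideanSpace ℝ (Fin 3))) • (x - (y : EuclideanSpace ℝ (Fin 3)))) 0) →
      ∀ s t : EuclideanSpace ℝ (Fin 3), t ≠ 0 →
        s ∉ Submodule.span ℝ ({t} : Set (EuclideanSpace ℝ (Fin 3))) →
        (∀ x : EuclideanSpace ℝ (Fin 3), x + t ∈ Λ ↔ x ∈ Λ) →
        (∀ x : EuclideanSpace ℝ (Fin 3), x + s ∈ Λ ↔ x ∈ Λ) →
        (∀ w : EuclideanSpace ℝ (Fin 3), (∀ x : EuclideanSpace ℝ (Fin 3), x + w ∈ Λ ↔ x ∈ Λ) →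
          w ∈ Submodule.span ℝ ({s, t} : Set (EuclideanSpace ℝ (Fin 3)))) →
      ∀ ω ω' : Set (EuclideanSpace ℝ (Fin 3)),
        (∀ R : ℝ, ∃ v : EuclideanSpace ℝ (Fin 3),
          {z : EuclideanSpace ℝ (Fin 3) | z ∈ ω ∧ ‖z‖ ≤ R} =
            {z : EuclideanSpace ℝ (Fin 3) | z + v ∈ Λ ∧ ‖z‖ ≤ R}) →
        (∀ R : ℝ, ∃ v : EuclideanSpace ℝ (Fin 3),
          {z : EuclideanSpace ℝ (Fin 3) | z ∈ ω' ∧ ‖z‖ ≤ R} =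
            {z : EuclideanSpace ℝ (Fin 3) | z + v ∈ Λ ∧ ‖z‖ ≤ R}) →
        ∀ (u : EuclideanSpace ℝ (Fin 3)) (a : ℝ), u ≠ 0 → inner ℝ s u = 0 → inner ℝ t u = 0 →
          (∀ z : EuclideanSpace ℝ (Fin 3), inner ℝ z u < a → (z ∈ ω ↔ z ∈ ω')) → ω = ω' ) →
    FLCEquilibriumPeriodic := by
  intro h0 h1 h2 Λ δ r hδ hr hsep hden hFLC hbal
  -- rung 1: a non-zero period
  have r1 : ∃ t : EuclideanSpace ℝ (Fin 3), t ≠ 0 ∧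
      ∀ x : EuclideanSpace ℝ (Fin 3), x + t ∈ Λ ↔ x ∈ Λ := by
    by_contra hno
    have hno' : ∀ t : EuclideanSpace ℝ (Fin 3), t ≠ 0 →
        ¬ (∀ x : EuclideanSpace ℝ (Fin 3), x + t ∈ Λ ↔ x ∈ Λ) :=
      fun t ht hper => hno ⟨t, ht, hper⟩
    rcases hbl_span_eq_top_or_pair hδ hr hsep hden hFLC with
      hspan | ⟨ω, ω', hω, hω', u, hu, hagree, hne⟩
    · have hle : Submodule.span ℝ {t : EuclideanSpace ℝ (Fin 3) |
          ∀ x : EuclideanSpace ℝ (Fin 3), x + t ∈ Λ ↔ x ∈ Λ} ≤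
          Submodule.span ℝ ({0} : Set (EuclideanSpace ℝ (Fin 3))) := by
        refine Submodule.span_mono fun t ht => ?_
        by_contra ht0
        exact hno' t ht0 ht
      rw [hspan, top_le_iff] at hle
      exact hbl_span_singleton_ne_top (0 : EuclideanSpace ℝ (Fin 3)) hle
    · exact hne (h0 Λ δ r hδ hr hsep hden hFLC hbal hno' ω ω' hω hω' u 0 hu hagree)
  obtain ⟨t, ht0, ht⟩ := r1
  -- rung 2: a period off the line `ℝ t`
  have r2 : ∃ s : EuclideanSpace ℝ (Fin 3),
      s ∉ Submodule.span ℝ ({t} : Set (EuclideanSpace ℝ (Fin 3))) ∧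
      ∀ x : EuclideanSpace ℝ (Fin 3), x + s ∈ Λ ↔ x ∈ Λ := by
    by_contra hno
    have hline : ∀ s : EuclideanSpace ℝ (Fin 3),
        (∀ x : EuclideanSpace ℝ (Fin 3), x + s ∈ Λ ↔ x ∈ Λ) →
        s ∈ Submodule.span ℝ ({t} : Set (EuclideanSpace ℝ (Fin 3))) := by
      intro s hs
      by_contra h
      exact hno ⟨s, h, hs⟩
    rcases hbl_span_eq_top_or_pair hδ hr hsep hden hFLC with
      hspan | ⟨ω, ω', hω, hω', u, hu, hagree, hne⟩
    · have hle : Submodule.span ℝ {w : EuclideanSpace ℝ (Fin 3) |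
          ∀ x : EuclideanSpace ℝ (Fin 3), x + w ∈ Λ ↔ x ∈ Λ} ≤
          Submodule.span ℝ ({t} : Set (EuclideanSpace ℝ (Fin 3))) :=
        Submodule.span_le.2 fun w hw => hline w hw
      rw [hspan, top_le_iff] at hle
      exact hbl_span_singleton_ne_top t hle
    · have htω := hbl_hull_period ht hω
      have htω' := hbl_hull_period ht hω'
      by_cases htu : inner ℝ t u = 0
      · exact hne (h1 Λ δ r hδ hr hsep hden hFLC hbal t ht0 ht hline ω ω' hω hω' u 0 hu htu hagree)
      · exact hne (hbl_eq_of_agree_of_inner_ne_zero htω htω' htu hagree)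
  obtain ⟨s, hs, hsper⟩ := r2
  -- rung 3: the periods span `ℝ³`
  have r3 : Submodule.span ℝ {w : EuclideanSpace ℝ (Fin 3) |
      ∀ x : EuclideanSpace ℝ (Fin 3), x + w ∈ Λ ↔ x ∈ Λ} = ⊤ := by
    by_contra hne_top
    have hplane : ∀ w : EuclideanSpace ℝ (Fin 3),
        (∀ x : EuclideanSpace ℝ (Fin 3), x + w ∈ Λ ↔ x ∈ Λ) →
        w ∈ Submodule.span ℝ ({s, t} : Set (EuclideanSpace ℝ (Fin 3))) := by
      intro w hw
      by_contra hwn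
      exact hne_top (hbl_span_eq_top_of_three ht0 hs hwn ht hsper hw)
    rcases hbl_span_eq_top_or_pair hδ hr hsep hden hFLC with
      hspan | ⟨ω, ω', hω, hω', u, hu, hagree, hne⟩
    · exact hne_top hspan
    · have htω := hbl_hull_period ht hω
      have htω' := hbl_hull_period ht hω'
      have hsω := hbl_hull_period hsper hω
      have hsω' := hbl_hull_period hsper hω'
      by_cases htu : inner ℝ t u = 0
      · by_cases hsu : inner ℝ s u = 0
        · exact hne (h2 Λ δ r hδ hr hsep hden hFLC hbal s t ht0 hs ht hsper hplane ω ω' hω hω'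
            u 0 hu hsu htu hagree)
        · exact hne (hbl_eq_of_agree_of_inner_ne_zero hsω hsω' hsu hagree)
      · exact hne (hbl_eq_of_agree_of_inner_ne_zero htω htω' htu hagree)
  exact exists_periodicConfiguration_of_span_eq_top hδ hsep hden r3

end Summit.AtomisticToContinuum.Crystallization.Theorems.HolmgrenBoyleLind

end
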